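import Mathlib
import HarnessLib
import HarnessLib.Audit
import Summits.AtomisticToContinuum.Statement

/-!
Route: BECRieszLandscape

CLOSED (retired) 2026-08-15T13:40:14Z by operator:999:1257524 — reason: not-a-thesis: assembly does not conclude the sub-problem Statement — note: D-0027 §2.1 audit (human 2026-08-15: routes that do not decide the summit are removed): the assembly concludes `Literature.MathematicalPhysics.QuantumManyBody.BoseGas.BoseEinsteinCondensation`, not the sub-problem statement; a NEW conforming route may be opened from the same idea (generated `closes . The file is kept as the record of this route; refuted decls are indexed as negative knowledge (`ledger negatives`).

# Route BECRieszLandscape — positive ground-state slices are reverse-Hölder at every scale (Riesz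
s=2 landscape + John–Nirenberg) ⇒ flat-mode BEC

X = PositiveZeroMode: it suffices to show that for every repulsive finite-range v and all small ρ,
NON-NEGATIVE δ-near-minimisers
(δ chosen after N) of the Dirichlet N-body energy in the box of side L = (N/ρ)^{1/3} occupy the flat
mode φ₀ = L^{-3/2}1_Λ
macroscopically, ⟨φ₀, γ_Ψ φ₀⟩ ≥ cN. For Ψ ≥ 0 this is the SLICE identity ⟨φ₀,γ_Ψφ₀⟩/N =
E_X̂[(⨍√g_X̂)²], g_X̂(y) =
Ψ(y,X̂)²/⨍Ψ(·,X̂)² the normalised conditional one-body density (Papangelou intensity /ρ) — a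
reverse-Hölder (A_∞-type) property
of the weight w_X̂ = e^{−W_X̂}, W the "landscape". Card riesz-dtn-trace-bmo-landscape: beyond the
healing length W_X̂ is the
potential of a super-Coulombic Riesz gas with s = d−1 = 2 (= trace on the slice of a 4-D Coulomb
potential), whose local laws
give scale-wise oscillation control, and John–Nirenberg turns that into reverse Hölder. The route
files X through its robust
two-scale form: CoarseGrainedReverseHolder (E_X̂ Σ_Q |Q|/L³ · g_Q² ≤ C for the cube-averaged
density, every fixed resolution ℓ)
∧ MicroscaleFlatness (mass fraction of cubes on which the slice concentrates is < 1), glued by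
TwoScaleGlue; X reaches the conjunct through
the shared fixed-N items GroundStateRigidity (phase rigidity of near-minimisers),
GroundStateEnergyFinite, OccupationStability and the
new PositiveNearMinimiserExists, composed in PositivityTransfer, and the proved frame
bec_of_zeroMode.
Lean: `∀ v : ℝ → ENNReal,
Literature.MathematicalPhysics.QuantumManyBody.BoseGas.IsRepulsiveFiniteRange v → ∃ ρ₀ : ℝ, 0 < ρ₀ ∧
∀ ρ : ℝ, 0 < ρ → ρ < ρ₀ → ∃ c : ℝ, 0 < c ∧ ∀ᶠ N : ℕ in Filter.atTop, ∃ δ : ENNReal, 0 < δ ∧ ∀ Ψ :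
Literature.MathematicalPhysics.QuantumManyBody.BoseGas.TrialState N
(Literature.MathematicalPhysics.QuantumManyBody.BoseGas.sideLength ρ N),
Literature.MathematicalPhysics.QuantumManyBody.BoseGas.energy v Ψ ≤
Literature.MathematicalPhysics.QuantumManyBody.BoseGas.groundStateEnergy v N
(Literature.MathematicalPhysics.QuantumManyBody.BoseGas.sideLength ρ N) + δ → (∀ X, Ψ.ψ X = (‖Ψ.ψ X‖
: ℂ)) → ENNReal.ofReal (c * N) ≤ Literature.MathematicalPhysics.QuantumManyBody.BoseGas.occupation N
((Literature.MathematicalPhysics.QuantumManyBody.BoseGas.box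
(Literature.MathematicalPhysics.QuantumManyBody.BoseGas.sideLength ρ N)).indicator fun _ =>
((Real.sqrt (Literature.MathematicalPhysics.QuantumManyBody.BoseGas.sideLength ρ N ^ 3))⁻¹ : ℂ))
Ψ.ψ`

## Assembly
Pure logic given the tree: TwoScaleGlue turns the two typed slice cruxes into PositiveZeroMode,
PositivityTransfer (with the three
fixed-N items and the existence lemma) turns that into X_B1,
and the PROVED theorem AtomisticToContinuum.BECInfraredBound.bec_of_zeroMode
(Theorems/BECInfraredBoundAssembly.lean:
occupation_le_maxOccupation + le_condensateNumber) gives the conjunct; `fun h1 … h8 =>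
bec_of_zeroMode (h8 h4 h5 h6 h7 (h3 h1 h2))`
elaborates in Sketch.lean (axioms propext, Classical.choice, Quot.sound). The informal cruxes
BoseRieszMembership (rank 3) and
RieszLandscapeLocalLaw (rank 4), filed right after open, are the intended PROOF of
CoarseGrainedReverseHolder, not assembly inputs.

Rationale: WHY THIS LINE. The barrier audit KineticGapLengthScalesNarrow isolates positivity of Ψ₀ plus
repulsion as an untested exit from the energy-window
class: every decondensing witness in print is complex (Galilei boosts) or lives at v = 0. For Ψ ≥ 0
condensation is exactly
non-concentration of the conditional density of one particle given the others, and −log of that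
density is, at scales ≫ ξ =
(8πρa)^{-1/2}, the potential of a classical Riesz gas with exponent s = 2 = d−1 at small coupling Γ
= 2π^{-3/2}(ρa³)^{1/6}
(Reatto–Chester tail u = π^{-3/2}(a/ρ)^{1/2} r^{-2}, ReattoChester1967, Reatto1969, McMillan1965;
Riesz conventions
Lewin2022, Serfaty2024) — the class for which local laws down to the microscale now exist
(PeilenSerfaty2025 Thm 1, Cor. 1.1;
LebleSerfaty2017; PetracheSerfaty2015 for the extension representation, CaffarelliSilvestre2007).
Imported areas: Coulomb/Riesz-gas
probability (local laws, discrepancy tails), real-variable harmonic analysis (John–Nirenberg / A_∞ ⇔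
reverse Hölder; the tree already
proves Literature.Analysis.FunctionSpaces.john_nirenberg), point-process conditioning
(GNZ/Papangelou). Versus the other routes: no gap, no energy
asymptotics, no pinning, no RG; versus the positivity routes opened in parallel today
(BECPalmLandscape: Debye-screened landscape with
the unsplit existential target E_Q[1/r] ≤ C; BECGhostPlasma: Riccati/cluster ghost plasma;
BECConditionalEntropy: Rényi/MI; BECSwapAffinity)
it SHARES the fixed-N reduction items verbatim (GroundStateRigidity, OccupationStability,
GroundStateEnergyFinite) and differs in engine
(super-Coulombic Riesz local laws + John–Nirenberg, no screening or cluster expansion) and in the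
typed target (scale-resolved: RH₂ of
cube averages at every resolution + a bad-mass fraction, universal over positive near-minimisers).
The target is typed on Dirichlet near-minimisers so the proved frame
AtomisticToContinuum.BECInfraredBound.bec_of_zeroMode closes the assembly; the audits' correction
(sup-over-cubes BMO is false
by rare voids; use an integrability form) is built in: only volume-averaged, cube-averaged,
mass-weighted quantities appear.

RANKED CRUXES. #0 PositiveZeroMode (target) — X: for every repulsive finite-range v there is ρ₀ > 0
such that for 0 < ρ < ρ₀ there is c > 0 with: for all large N there is δ > 0 such that every
Dirichlet trial state Ψ in the box of side (N/ρ)^{1/3} with energy ≤ E₀ + δ AND Ψ ≥ 0 pointwise (Ψ =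
‖Ψ‖ as a complex number) has flat-mode occupation ⟨φ₀,γ_Ψφ₀⟩ ≥ cN (X_B1 of route BECInfraredBound
restricted to non-negative near-minimisers). (why it might fail: Positive near-minimisers could
decondense through phase-free correlated (Jastrow-type) amplitude structure that repulsion does not
penalise at an L-independent rate (KineticGapLengthScalesNarrow exit (b) is untested); the d=1
hard-core analogue (Girardeau, n₀ ≍ √N) is positive and fails.) [LSSY2005, PenroseOnsager1956,
Reatto1969, Literature.Barriers.AtomisticToContinuum.KineticGapLengthScalesNarrow,
Literature.Barriers.AtomisticToContinuum.OneDimensionalHardCore]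
#2 CoarseGrainedReverseHolder (crux) — (card R1+R2+R3 in typed, robust form) for every resolution ℓ
> 0 there is C such that for all large N = n+1 there is δ > 0 with: for every non-negative
δ-near-minimiser Ψ, partitioning [0,L)³ into m³ congruent cubes Q (m = ⌊L/ℓ⌋), the (N−1)-marginal
expectation of the second moment of the cube-averaged normalised slice density is bounded: m³ ∫dX̂
Σ_Q (∫_Q |Ψ(y,X̂)|²dy)² / ∫|Ψ(y,X̂)|²dy ≤ C, i.e. E_μ̂[Σ_Q (|Q|/L³) g_Q²] ≤ C uniformly in N
(reverse Hölder RH₂ of the coarse-grained slice weight; = 1 + Var of the coarse-grained landscape to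
leading order, ≈ 1 + O(√(ρa³)); v = 0 gives (3/2)³). [difficulty: open-problem] (why it might fail:
Needs −2log Ψ₀(·,X̂) bounded below off rare voids at all scales ≥ ℓ, uniformly in L: a many-body
infrared term in −log Ψ₀ (u₃ with non-summable vertex — the d=3, T=0 marginal logs) or void
statistics fatter than exp(−cR⁴) against the e^{R/ξ} gain would make E Σ_Q p_Q g_Q² grow with N.)
[PeilenSerfaty2025, ReattoChester1967, Reatto1969, McMillan1965, JohnNirenberg1961, LSSY2005,
Literature.Barriers.AtomisticToContinuum.BogoliubovPerturbationInfrared]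
#5 MicroscaleFlatness (crux) — (card R1 microscale part) there are ℓ > 0, c₀ > 0 and θ < 1 such that
for all large N = n+1 there is δ > 0 with: for every non-negative δ-near-minimiser Ψ and the same
cube partition at resolution ℓ, the expected slice mass carried by BAD cubes — cubes Q with (∫_Q
Ψ(y,X̂)dy)² < c₀|Q|∫_QΨ(y,X̂)²dy, i.e. on which y ↦ Ψ(y,X̂) concentrates — is at most θ: ∫dX̂ Σ_{Q
bad} ∫_Q Ψ(y,X̂)²dy ≤ θ (intended ℓ ≈ ρ^{-1/3}/10 ≫ a: most cubes see no particle and the slice is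
nearly constant on them; hard cores and the wall layer cost volume fraction O(ρa³ + ξ/L)).
[difficulty: L] (why it might fail: Sub-interparticle flatness of y ↦ Ψ₀(y,X̂) at fixed environment
is a one-particle Harnack claim for a function that solves no PDE in y alone (only the
3N-dimensional equation); many-body caging near hard cores at moderate ρa³ could make a
mass-relevant family of cubes bad for every c₀.) [LSSY2005, McMillan1965, ReedSimonIV1978,
Reatto1969]
#6 GroundStateRigidity (crux) — (shared with routes BECPalmLandscape / BECSwapAffinity /
BECConditionalEntropy, verbatim) phase rigidity of near-minimisers at fixed N: for admissible v
there is ρ₀ such that for ρ < ρ₀ and all large N, for every η > 0 there is δ > 0 such that any two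
δ-near-minimisers Ψ, Φ in the Dirichlet box of side (N/ρ)^{1/3} satisfy ∫|Ψ − cΦ|² ≤ η for some unit
complex c (E₀ < ∞, compact resolvent, unique positive ground state, spectral gap at fixed N). It is
what lets positivity be assumed in the other cruxes. [difficulty: M] (why it might fail: Hard cores
/ ⊤-shells disconnect the configuration space; uniqueness then needs every non-dilute component
(jammed or bound clusters) to sit strictly above E₀ at each large N — low-density connectivity of
hard-sphere configuration spaces is not in the library and open in general.) [ReedSimonIV1978,
doi:10.1093/imrn/rnt012, LSSY2005]
#9 TwoScaleGlue (support) — CoarseGrainedReverseHolder → MicroscaleFlatness → PositiveZeroMode. Real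
analysis + Fubini: for Ψ ≥ 0, ⟨φ₀,γ_Ψφ₀⟩ = N L⁻³ ∫dX̂ (∫Ψ(y,X̂)dy)² (occupation unfolds along
Matrix.vecCons); pointwise in X̂, with good cubes G, Σ_Q∫_Q Ψ ≥ √(c₀|Q|) Σ_G (∫_QΨ²)^{1/2} and
Hölder Σ_G w_Q ≤ (Σ_G w_Q^{1/2})^{2/3}(Σ w_Q²)^{1/3} give (∫Ψ_X̂)² ≥ c₀ L³ M(X̂)(1−b(X̂))³/C₂(X̂)
with M the slice mass, b the bad-mass fraction, C₂ = m³Σ_Q w_Q²/M²; then Markov under μ̂ = M dX̂ (∫M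
= 1) using E_μ̂ C₂ ≤ C and E_μ̂ b ≤ θ < 1; finally intersect the eventual ranges, min of ρ₀'s and
δ's, shift n+1 ↦ N. [difficulty: provable-now] [LSSY2005, Stein1993]
#9 GroundStateEnergyFinite (support) — (shared with BECPinning / BECSwapAffinity, verbatim) for
repulsive finite-range v (range R₀) there is ρ₀ > 0 such that for ρ < ρ₀ and all large N the
Dirichlet ground-state energy in the box of side (N/ρ)^{1/3} is finite (N disjoint symmetric C¹
bumps at mutual distance > R₀). [difficulty: provable-now] [LSSY2005]
#9 PositiveNearMinimiserExists (support) — whenever E₀(N, L) < ⊤, for every δ > 0 there is a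
δ-near-minimiser Φ ∈ TrialState N L with Φ = ‖Φ‖ pointwise. Construction without mollifiers: from a
δ/2-near-minimiser Ψ put Φ_ε := (√(|Ψ|² + ε²) − ε)/‖·‖₂ — C¹ (|Ψ|² is C¹, t ↦ √(t+ε²) smooth),
symmetric, vanishes exactly where Ψ does (box, cores), |∇Φ_ε| ≤ |∇Ψ| and Φ_ε ≤ |Ψ| pointwise, ‖Φ_ε‖₂
→ 1; so energy Φ_ε ≤ E₀ + δ for small ε. [difficulty: provable-now] [LSSY2005, ReedSimonIV1978]
#9 OccupationStability (support) — (shared with BECPalmLandscape, verbatim) for a normalised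
measurable mode u, Ψ, Φ ∈ TrialState (n+1) L and |c| = 1: occ(u,Ψ)^{1/2} ≤ occ(u,Φ)^{1/2} +
(n+1)^{1/2}‖Ψ − cΦ‖₂ (Minkowski in L²(dY) for F_Ψ(Y) = ⟨u, Ψ(·,Y)⟩). [difficulty: provable-now]
[LSSY2005, PenroseOnsager1956]
#9 PositivityTransfer (support) — GroundStateEnergyFinite → GroundStateRigidity →
PositiveNearMinimiserExists → OccupationStability → PositiveZeroMode → X_B1 (flat-mode occupation ≥
(c/4)N for ALL δ-near-minimisers, the hypothesis of the proved
AtomisticToContinuum.BECInfraredBound.bec_of_zeroMode): for ρ below the four thresholds and N in the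
four eventual ranges take η = c/4, δ = min(δ_pos, δ_rig(η)); a δ-near-minimiser Ψ and a positive
δ-near-minimiser Φ (exists since E₀ ≠ ⊤) are η-close up to a unit phase, occ(Φ) ≥ cN, and stability
gives √occ(Ψ) ≥ √(cN) − √N√η = √(cN)/2 (ENNReal rpow bookkeeping; N = 0 trivial). [difficulty:
provable-now] [LSSY2005, ReedSimonIV1978, PenroseOnsager1956]

TWO-LAYER PLAN. CoarseGrainedReverseHolder ⇐ BoseRieszMembership → RieszLandscapeLocalLaw →
CoarseGrainedReverseHolder (glue: one-sided dyadic
John–Nirenberg from the machinery of Literature/Analysis/FunctionSpaces/BMOJohnNirenberg.lean, plus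
a near-field Poisson layer for
scales ρ^{-1/3}/10 … ξ where the pair factor is 1 − a/r). MicroscaleFlatness ⇐ SliceHarnack
(Feynman–Kac bridge comparison in the
tagged coordinate) → CoreLayer (excluded volume O(ρa³), wall layer O(ξ/L)) → MicroscaleFlatness.
GroundStateRigidity ⇐ (a.e.-finite v:
compact resolvent + Perron–Frobenius) → HardCoreLimit (monotone forms / connectivity at low density)
→ GroundStateRigidity. Periodic twin of the target
(feeds BECPeriodicReduction.PeriodicBEC by the same glue with condensateOccupation) once the
Dirichlet version moves.

KILL CRITERIA. ¬CoarseGrainedReverseHolder for some admissible v at arbitrarily small ρ (E_μ̂ Σ_Q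
p_Q g_Q² unbounded along N at a fixed ℓ, e.g. from
a rigorous lower bound on void probabilities of |Ψ₀|² slower than the landscape gain, or from an
infrared many-body term) closes the
route: `close --reason refuted:CoarseGrainedReverseHolder`. ¬PositiveZeroMode kills every positivity
route at once (hand to the
negatives index; card family riesz-*/palm-*/renyi-*/swap-* dies). ¬MicroscaleFlatness alone ⇒ pivot:
restate with balls and a
maximal-function threshold at smaller ℓ (--restate). ¬GroundStateRigidity via a hard-core degeneracy
witness ⇒ restate it for a.e.-finite v and add the
monotone hard-core limit as support (shared repair with the three sibling routes). X_B1 (stmt of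
BECInfraredBound) or PeriodicBEC ∧ BoundaryTransfer proved elsewhere
moots the route (superseded).

NOT DECOMPOSED YET. The classical engine itself: the neutralised box/torus Riesz-s Gibbs measure is
not a Lean object (definition request below), so
RieszLandscapeLocalLaw and BoseRieszMembership are filed informal; the norm in which the many-body
remainder of −log Ψ₀ must be
small; the Debye–Hückel corner (Γ → 0, screening length ξ ≫ ρ^{-1/3}) versus PeilenSerfaty2025's β ≳
1 estimates; the extension
identity (Riesz-2 energy on ℝ³ = Dirichlet energy of the harmonic extension to ℝ⁴₊,
CaffarelliSilvestre2007 / PetracheSerfaty2015)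
used inside the engine; constants c₀, θ, C as functions of ρa³; the periodic twin; T > 0.

CHEAPEST FALSIFIER. (i) v = 0 (a = 0, every ρ): the Dirichlet ground state ∏ sin gives Σ_Q p_Q g_Q²
→ (3/2)³ = 3.375 and no bad cubes — done by hand,
passes; near-minimisers are handled by δ after N (gap π²-scale/L²). (ii) VMC/PIMC-ground-state kit
job for refuters (not run here:
one-shot planner seat): sample X̂ from |Ψ_J|² for the LSSY/Dyson nearest-neighbour Jastrow state and
for the Reatto–Chester-tailed
Jastrow state at ρa³ ∈ {1e-4, 1e-3, 1e-2}, N ∈ {128, …, 2048}, ℓ ∈ {ρ^{-1/3}/10, ξ, 4ξ}; estimate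
m³Σ_k(∫_Q w)²/(M·1) averaged over
X̂ and the bad-mass fraction at c₀ = 1/2: any growth in N at fixed ℓ retires
CoarseGrainedReverseHolder for that trial class and
with it the line. (iii) Analytic: exhibit a positive symmetric near-minimising family (δ_N → 0
slower than the gap) whose slices
concentrate on volume o(L³) — would refute PositiveZeroMode as typed (δ after N guards against the
amplitude-modulation witnesses of
KineticGapLengthScalesNarrow at v = 0).

NUMBERS. u(r) = π^{-3/2}(a/ρ)^{1/2} r^{-2} for r ≫ ξ (from S(k) ≈ k/c, c = 4√(πρa), û = c/(2ρk),
units ħ = 2m = 1); Γ := 2u(ρ^{-1/3}) =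
2π^{-3/2}(ρa³)^{1/6} (0.036 at ρa³ = 10⁻⁶); ξ = (8πρa)^{-1/2}, ρξ³ = (8π)^{-3/2}(ρa³)^{-1/2} ≫ 1;
landscape variance ≍ √(ρa³)
(UV-dominated: spectral density |û|²ρS(k)k² ∝ k below 1/ξ); void of radius R lowers the landscape by
≍ R/ξ; free-gas value of the
RH₂ functional (3/2)³; Peilen–Serfaty: local laws for ℓ ≥ ρ_β N^{-1/d}, tails C₁e^{−C₂βNℓ^d},
β-uniform only for β ≥ 1 (Thm 1). Items at
open: 10 typed (target, 3 cruxes incl. the shared GroundStateRigidity, 5 supports of which 2 shared,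
assembly) + 2 informal cruxes + 1 definition request.

DEFINITION REQUESTS. NeutralizedRieszGas (topic Literature/Probability/Process or
MathematicalPhysics/StatisticalMechanics): for s ∈ (d−2, d), L > 0, β > 0,
N: the canonical Gibbs probability measure on ([0,L)³)^N with density ∝ exp(−β[Σ_{i<j}
G_{s,L}(x_i−x_j)]), G_{s,L} the Lℤ³-periodic
zero-mean kernel with Fourier coefficients c_{3,s}|k|^{s−3} (k ∈ (2π/L)ℤ³∖0; heat-kernel/Ewald
formula for absolute convergence),
optionally UV-regularised below a length r₀ and multiplied by a bounded non-negative finite-range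
pair weight; plus its potential field
h_N(y) = Σ_j G_{s,L}(y − x_j). Needed to give RieszLandscapeLocalLaw (rank 4) a signature and to
vendor PeilenSerfaty2025 Thm 1 as a
named fact. Filed with `ledger workitem add --kind definition` after open.

Novelty: Searches (2026-08-15): `ledger idea list --problem AtomisticToContinuum --sub
BoseEinsteinCondensation` (116 cards; Riesz appears
only in this card and riesz-shadow-harmonic-extension); `ledger negatives` (0); `lit search --source
zbmath "Riesz gas local laws"`
(5: arXiv:2511.18623, arXiv:2112.05881, 3 noise); `lit search --source zbmath "Jastrow Bose
condensation"` (2, GP free energy /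
trapped-gas density matrices, irrelevant); `lit search --source crossref "John-Nirenberg inequality
Bose gas condensate"` (0
relevant); `lit search --source arxiv …` (HTTP 429 all session), OpenAlex budget exhausted; `lit
frontier AtomisticToContinuum
--since 2022` (30 rows; BEC descendants arXiv:2510.20493, arXiv:2603.20776 — kinetic-localisation
class); `lit bridges
AtomisticToContinuum --cross any` (no Bose ↔ Riesz/Coulomb-gas bridge); `lit galaxy search
"emptiness formation probability" --star
all` (1 panama hit, Korepin–Bogoliubov–Izergin, 1-D); `lit read arXiv:2511.18623` pp. 1–7 (Thm 1
local laws to the microscale with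
tails, Cor. 1.1 discrepancy/fluctuation/minimal-distance, Thm 2 exponential moments; confining V on
ℝ^d, bulk cubes, β ≥ 1 sharp);
`lean search` BMO/JohnNirenberg (Literature.Analysis.FunctionSpaces.john_nirenberg, proved),
Riesz/Coulomb Gibbs measures (none).
Nearest prior art found: PeilenSerfaty2025 (arXiv:2511.18623: the classical engine, no bosons);
Reatto1969 / ReattoChester1967 /
McMillan1965 (|Ψ_J|² as a classical gas with 1/r² tail and ODLRO of Jastrow states, ph  [refs: 2511.18623, 2112.05881, 2510.20493, 2603.20776, PeilenSerfaty2025, Reatto1969, ReattoChester1967, McMillan1965]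

Barriers (technique_class: riesz-gas-local-laws harmonic-extension BMO-positivity): - technique_class: riesz-gas-local-laws harmonic-extension BMO-positivity
- Literature.Barriers.AtomisticToContinuum.KineticGapLengthScales: evaded — no step "depletion ≤
gap⁻¹ × energy excess"; the cruxes are not energy-window statements (positivity hypothesis, δ after
N), precisely exit (b) of Literature.Barriers.AtomisticToContinuum.KineticGapLengthScalesNarrow; the
Galilei-boost and phase-modulation witnesses are complex and excluded, the v = 0 amplitude
modulations cost N t²/L² > δ.
- Literature.Barriers.AtomisticToContinuum.BogoliubovPerturbationInfrared: applies to
BoseRieszMembership only (static structure of −log Ψ₀ beyond the pair tail); the typed cruxes ask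
for one-sided, volume-averaged landscape control, not a convergent particle-representation
expansion; honest bet: if the three-body term carries non-summable infrared weight the membership
fails and CoarseGrainedReverseHolder must be fed differently (kill signal recorded).
- Literature.Barriers.AtomisticToContinuum.EnergyAsymptoticsWithoutCondensation: evaded — e₀(ρ), LHY
and any energy asymptotics are never used; the 1-D witness is reproduced on the right side (s = 0
log-gas landscape is log-correlated ⇒ RH₂ constant grows ⇒ n₀ = o(N)).
- Literature.Barriers.AtomisticToContinuum.PitaevskiiStringariOneDimension: consistent — T = 0, d =
3 only; the s = d−1 landscape variance ∫k^{d−2}dk is finite iff d ≥ 2 and the reverse-Hölder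
constant is uniform only there.
- Literature.Barriers.AtomisticToContinuum.OneDimensio

History (route lifecycle, newest last):
- 2026-08-15T13:40:14Z · CLOSED retired — not-a-thesis: assembly does not conclude the sub-problem Statement (operator:999:1257524)

sub-problem: BoseEinsteinCondensation · status: closed(retired) · opened planner-plancard-AtomisticToContinuum-BoseEin-e016c558-0 2026-08-15T11:47:25Z · rev 0 · ledger route-AtomisticToContinuum-BECRieszLandscape
GENERATED by the gate from the ledger (D-0016/17). Provers cite these decls: `theorem foo : Summit.AtomisticToContinuum.BoseEinsteinCondensation.Theses.BECRieszLandscape.<Decl> := …` in Summits/AtomisticToContinuum/BoseEinsteinCondensation/Theorems/<Name>.lean.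
-/

namespace Summit.AtomisticToContinuum.BoseEinsteinCondensation.Theses.BECRieszLandscape

open scoped BigOperators Topology Manifold Classical MeasureTheory ProbabilityTheory Matrix InnerProductSpace ComplexConjugate ContinuousMap
open Filter Set Function TopologicalSpace MeasureTheory

attribute [summit_statement] _root_.BoseEinsteinCondensation

/-- item stmt-AtomisticToContinuum-6485 · target · rank 0 · closed · moot by None · by planner
why it might fail: Positive near-minimisers could decondense through phase-free correlated (Jastrow-type) amplitude structure that repulsion does not penalise at an L-independent rate (KineticGapLengthScalesNarrow exit (b) is untested); the d=1 hard-core analogue (Girardeau, n₀ ≍ √N) is positive and fails.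
sources: LSSY2005, PenroseOnsager1956, Reatto1969, Literature.Barriers.AtomisticToContinuum.KineticGapLengthScalesNarrow, Literature.Barriers.AtomisticToContinuum.OneDimensionalHardCore
[target] X: for every repulsive finite-range v there is ρ₀ > 0 such that for 0 < ρ < ρ₀ there is c >
0 with: for all large N there is δ > 0 such that every Dirichlet trial state Ψ in the box of side
(N/ρ)^{1/3} with energy ≤ E₀ + δ AND Ψ ≥ 0 pointwise (Ψ = ‖Ψ‖ as a complex number) has flat-mode
occupation ⟨φ₀,γ_Ψφ₀⟩ ≥ cN (X_B1 of route BECInfraredBound restricted to non-negative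
near-minimisers). -/
@[route_item "route-AtomisticToContinuum-BECRieszLandscape"]
def PositiveZeroMode : Prop :=
  ∀ v : ℝ → ENNReal, Literature.MathematicalPhysics.QuantumManyBody.BoseGas.IsRepulsiveFiniteRange v → ∃ ρ₀ : ℝ, 0 < ρ₀ ∧ ∀ ρ : ℝ, 0 < ρ → ρ < ρ₀ → ∃ c : ℝ, 0 < c ∧ ∀ᶠ N : ℕ in Filter.atTop, ∃ δ : ENNReal, 0 < δ ∧ ∀ Ψ : Literature.MathematicalPhysics.QuantumManyBody.BoseGas.TrialState N (Literature.MathematicalPhysics.QuantumManyBody.BoseGas.sideLength ρ N), Literature.MathematicalPhysics.QuantumManyBody.BoseGas.energy v Ψ ≤ Literature.MathematicalPhysics.QuantumManyBody.BoseGas.groundStateEnergy v N (Literature.MathematicalPhysics.QuantumManyBody.BoseGas.sideLength ρ N) + δ → (∀ X, Ψ.ψ X = (‖Ψ.ψ X‖ : ℂ)) → ENNReal.ofReal (c * N) ≤ Literature.MathematicalPhysics.QuantumManyBody.BoseGas.occupation N ((Literature.MathematicalPhysics.QuantumManyBody.BoseGas.box (Literature.MathematicalPhysics.QuantumManyBody.BoseGas.sideLength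 ρ N)).indicator fun _ => ((Real.sqrt (Literature.MathematicalPhysics.QuantumManyBody.BoseGas.sideLength ρ N ^ 3))⁻¹ : ℂ)) Ψ.ψ

/-- item stmt-AtomisticToContinuum-6486 · crux · rank 2 · closed · moot by None · by planner
why it might fail: Needs −2log Ψ₀(·,X̂) bounded below off rare voids at all scales ≥ ℓ, uniformly in L: a many-body infrared term in −log Ψ₀ (u₃ with non-summable vertex — the d=3, T=0 marginal logs) or void statistics fatter than exp(−cR⁴) against the e^{R/ξ} gain would make E Σ_Q p_Q g_Q² grow with N.
sources: PeilenSerfaty2025, ReattoChester1967, Reatto1969, McMillan1965, JohnNirenberg1961, LSSY2005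
[crux] (card R1+R2+R3 in typed, robust form) for every resolution ℓ > 0 there is C such that for all
large N = n+1 there is δ > 0 with: for every non-negative δ-near-minimiser Ψ, partitioning [0,L)³
into m³ congruent cubes Q (m = ⌊L/ℓ⌋), the (N−1)-marginal expectation of the second moment of the
cube-averaged normalised slice density is bounded: m³ ∫dX̂ Σ_Q (∫_Q |Ψ(y,X̂)|²dy)² / ∫|Ψ(y,X̂)|²dy ≤
C, i.e. E_μ̂[Σ_Q (|Q|/L³) g_Q²] ≤ C uniformly in N (reverse Hölder RH₂ of the coarse-grained slice
weight; = 1 + Var of the coarse-grained landscape to leading order, ≈ 1 + O(√(ρa³)); v = 0 gives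
(3/2)³). [difficulty: open-problem] -/
@[route_item "route-AtomisticToContinuum-BECRieszLandscape"]
def CoarseGrainedReverseHolder : Prop :=
  ∀ v : ℝ → ENNReal, Literature.MathematicalPhysics.QuantumManyBody.BoseGas.IsRepulsiveFiniteRange v → ∃ ρ₀ : ℝ, 0 < ρ₀ ∧ ∀ ρ : ℝ, 0 < ρ → ρ < ρ₀ → ∀ ℓ : ℝ, 0 < ℓ → ∃ C : ℝ, ∀ᶠ n : ℕ in Filter.atTop, ∃ δ : ENNReal, 0 < δ ∧ ∀ Ψ : Literature.MathematicalPhysics.QuantumManyBody.BoseGas.TrialState (n + 1) (Literature.MathematicalPhysics.QuantumManyBody.BoseGas.sideLength ρ (n + 1)), Literature.MathematicalPhysics.QuantumManyBody.BoseGas.energy v Ψ ≤ Literature.MathematicalPhysics.QuantumManyBody.BoseGas.groundStateEnergy v (n + 1) (Literature.MathematicalPhysics.QuantumManyBody.BoseGas.sideLength ρ (n + 1)) + δ → (∀ X, Ψ.ψ X = (‖Ψ.ψ X‖ : ℂ)) → let L := Literature.MathematicalPhysics.QuantumManyBody.BoseGas.sideLength ρ (n + 1); let m := ⌊L / ℓ⌋₊;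 ((m : ENNReal) ^ 3 * ∫⁻ X : Fin n → EuclideanSpace ℝ (Fin 3), ((∑ k : Fin 3 → Fin m, (∫⁻ y in {y : EuclideanSpace ℝ (Fin 3) | ∀ i, y i ∈ Set.Ico ((k i : ℝ) * (L / m)) (((k i : ℝ) + 1) * (L / m))}, (‖Ψ.ψ (Matrix.vecCons y X)‖₊ : ENNReal) ^ 2) ^ 2) / (∫⁻ y, (‖Ψ.ψ (Matrix.vecCons y X)‖₊ : ENNReal) ^ 2))) ≤ ENNReal.ofReal C

/-- item stmt-AtomisticToContinuum-6487 · crux · rank 5 · closed · moot by None · by planner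
why it might fail: Sub-interparticle flatness of y ↦ Ψ₀(y,X̂) at fixed environment is a one-particle Harnack claim for a function that solves no PDE in y alone (only the 3N-dimensional equation); many-body caging near hard cores at moderate ρa³ could make a mass-relevant family of cubes bad for every c₀.
sources: LSSY2005, McMillan1965, ReedSimonIV1978, Reatto1969
[crux] (card R1 microscale part) there are ℓ > 0, c₀ > 0 and θ < 1 such that for all large N = n+1
there is δ > 0 with: for every non-negative δ-near-minimiser Ψ and the same cube partition at
resolution ℓ, the expected slice mass carried by BAD cubes — cubes Q with (∫_Q Ψ(y,X̂)dy)² <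
c₀|Q|∫_QΨ(y,X̂)²dy, i.e. on which y ↦ Ψ(y,X̂) concentrates — is at most θ: ∫dX̂ Σ_{Q bad} ∫_Q
Ψ(y,X̂)²dy ≤ θ (intended ℓ ≈ ρ^{-1/3}/10 ≫ a: most cubes see no particle and the slice is nearly
constant on them; hard cores and the wall layer cost volume fraction O(ρa³ + ξ/L)). [difficulty: L] -/
@[route_item "route-AtomisticToContinuum-BECRieszLandscape"]
def MicroscaleFlatness : Prop :=
  ∀ v : ℝ → ENNReal, Literature.MathematicalPhysics.QuantumManyBody.BoseGas.IsRepulsiveFiniteRange v → ∃ ρ₀ : ℝ, 0 < ρ₀ ∧ ∀ ρ : ℝ, 0 < ρ → ρ < ρ₀ → ∃ ℓ c₀ θ : ℝ, 0 < ℓ ∧ 0 < c₀ ∧ θ < 1 ∧ ∀ᶠ n : ℕ in Filter.atTop, ∃ δ : ENNReal, 0 < δ ∧ ∀ Ψ : Literature.MathematicalPhysics.QuantumManyBody.BoseGas.TrialState (n + 1) (Literature.MathematicalPhysics.QuantumManyBody.BoseGas.sideLength ρ (n + 1)), Literature.MathematicalPhysics.QuantumManyBody.BoseGas.energy v Ψ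 ≤ Literature.MathematicalPhysics.QuantumManyBody.BoseGas.groundStateEnergy v (n + 1) (Literature.MathematicalPhysics.QuantumManyBody.BoseGas.sideLength ρ (n + 1)) + δ → (∀ X, Ψ.ψ X = (‖Ψ.ψ X‖ : ℂ)) → let L := Literature.MathematicalPhysics.QuantumManyBody.BoseGas.sideLength ρ (n + 1); let m := ⌊L / ℓ⌋₊; (∫⁻ X : Fin n → EuclideanSpace ℝ (Fin 3), (∑ k : Fin 3 → Fin m, if (∫⁻ y in {y : EuclideanSpace ℝ (Fin 3) | ∀ i, y i ∈ Set.Ico ((k i : ℝ) * (L / m)) (((k i : ℝ) + 1) * (L / m))}, (‖Ψ.ψ (Matrix.vecCons y X)‖₊ : ENNReal)) ^ 2 < ENNReal.ofReal (c₀ * (L / m) ^ 3) * ∫⁻ y in {y : EuclideanSpace ℝ (Fin 3) | ∀ i, y i ∈ Set.Ico ((k i : ℝ) * (L / m)) (((k i : ℝ) + 1) * (L / m))}, (‖Ψ.ψ (Matrix.vecCons y X)‖₊ : ENNReal) ^ 2 then ∫⁻ y in {y : EuclideanSpace ℝ (Fin 3) | ∀ i, y i ∈ Set.Ico ((k i :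 ℝ) * (L / m)) (((k i : ℝ) + 1) * (L / m))}, (‖Ψ.ψ (Matrix.vecCons y X)‖₊ : ENNReal) ^ 2 else 0)) ≤ ENNReal.ofReal θ

/-- item stmt-AtomisticToContinuum-3298 · crux · rank 6 · closed · moot by None · by planner
why it might fail: Hard cores / ⊤-shells disconnect the configuration space; uniqueness then needs every non-dilute component (jammed or bound clusters) to sit strictly above E₀ at each large N — low-density connectivity of hard-sphere configuration spaces is not in the library and open in general.
sources: ReedSimonIV1978, doi:10.1093/imrn/rnt012, LSSY2005
[crux] card item A2 (phase rigidity): ∀ admissible v ∃ρ₀ ∀ρ<ρ₀ ∀ᶠ N ∀η>0 ∃δ>0: any two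
δ-near-minimisers Ψ, Φ ∈ TrialState N L (L = (N/ρ)^(1/3)) satisfy ∫|Ψ − cΦ|² ≤ η for some unit
complex c (E₀ < ∞, compact resolvent, unique positive ground state and spectral gap of the Dirichlet
N-body problem at fixed N; for hard cores via connectedness / energetic dominance of the dilute
component of the hard-sphere configuration space). [difficulty: M] -/
@[route_item "route-AtomisticToContinuum-BECRieszLandscape"]
def GroundStateRigidity : Prop :=
  ∀ v : ℝ → ENNReal, Literature.MathematicalPhysics.QuantumManyBody.BoseGas.IsRepulsiveFiniteRange v → ∃ ρ₀ : ℝ, 0 < ρ₀ ∧ ∀ ρ : ℝ, 0 < ρ → ρ < ρ₀ → ∀ᶠ N : ℕ in Filter.atTop, ∀ η : ℝ, 0 < η → ∃ δ : ENNReal, 0 < δ ∧ ∀ Ψ Φ : Literature.MathematicalPhysics.QuantumManyBody.BoseGas.TrialState N (Literature.MathematicalPhysics.QuantumManyBody.BoseGas.sideLength ρ N), Literature.MathematicalPhysics.QuantumManyBody.BoseGas.energy v Ψ ≤ Literature.MathematicalPhysics.QuantumManyBody.BoseGas.groundStateEnergy v N (Literature.MathematicalPhysics.QuantumManyBody.BoseGas.sideLength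 ρ N) + δ → Literature.MathematicalPhysics.QuantumManyBody.BoseGas.energy v Φ ≤ Literature.MathematicalPhysics.QuantumManyBody.BoseGas.groundStateEnergy v N (Literature.MathematicalPhysics.QuantumManyBody.BoseGas.sideLength ρ N) + δ → ∃ c : ℂ, ‖c‖ = 1 ∧ ∫⁻ X, (‖Ψ.ψ X - c * Φ.ψ X‖₊ : ENNReal) ^ 2 ≤ ENNReal.ofReal η

-- item stmt-AtomisticToContinuum-7021 · support · rank 3 · closed · moot by None · by planner — informal only, no Lean statement yet:
--   [crux] BoseRieszMembership (card riesz-dtn-trace-bmo-landscape R1; informal until GNZ/Papangelou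
--   intensities and the neutralised Riesz gas are typed — see definition request NeutralizedRieszGas).
--   For admissible v and 0 < ρ < ρ₀(v), the Born law |Ψ₀|² of the positive Dirichlet ground state in
--   Λ_L, L = (N/ρ)^{1/3}, viewed as an N-point process, has conditional (Papangelou) intensity
--   ρ·g_X̂(y), g_X̂ = Ψ₀(y,X̂)²/⨍Ψ₀(·,X̂)², of the form g_X̂(y) ∝ exp(−W_X̂(y)) with landscape W_X̂(y) =
--   2Σ_j u_N(y − x_j) + w_sr(y,X̂) + w_mb(y,X̂), where (i) PAIR TAIL: u_N radial with u_N(r) r² → b_N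
--   for ξ ≪ r ≪ L and

-- item stmt-AtomisticToContinuum-7045 · support · rank 4 · closed · moot by None · by planner — informal only, no Lean statement yet:
--   [crux] RieszLandscapeLocalLaw (card riesz-dtn-trace-bmo-landscape R2; CLASSICAL probability,
--   informal until the definition request NeutralizedRieszGas lands; then typable over ([0,L)³)^N with
--   cellN of PeriodicBoseGas.lean). For the neutralised super-Coulombic Riesz gas of exponent s = 2 in
--   Λ_L ⊂ ℝ³ (torus or hard-wall box with uniform background), N = ρL³ points, pair kernel 2u with u(r)
--   = b/r² for r ≥ r₀ ~ ξ (UV-regularised below r₀), coupling Γ = 2bρ^{2/3} ≤ Γ₀ small, optionally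
--   multiplied by a bounded non-negative finite-range (≤ Kξ) pair weight with hard cores of diameter ≲ a
--   ≪ ρ^{-1/3}, a

/-- item stmt-AtomisticToContinuum-0850 · support · rank 9 · closed · moot by None · by planner
sources: LSSY2005
[support] GroundStateEnergyFinite: for repulsive finite-range v (range R₀) there is ρ₀>0 (ρ₀ < R₀⁻³
works) such that for ρ<ρ₀ and all large N the Dirichlet ground-state energy groundStateEnergy v N
((N/ρ)^{1/3}) is finite: exhibit one symmetric C¹ trial state made of N disjoint bumps at mutual
distance > R₀ (interaction_eq_zero_of_lt_dist), finite kinetic energy. Hypothesis of the Assembly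
(needed to subtract in ℝ≥0∞). [folklore; LiebSeiringerSolovejYngvason2005 (2.3)] -/
@[route_item "route-AtomisticToContinuum-BECRieszLandscape"]
def GroundStateEnergyFinite : Prop :=
  ∀ v : ℝ → ENNReal, Literature.MathematicalPhysics.QuantumManyBody.BoseGas.IsRepulsiveFiniteRange v → ∃ ρ₀ : ℝ, 0 < ρ₀ ∧ ∀ ρ : ℝ, 0 < ρ → ρ < ρ₀ → ∀ᶠ N : ℕ in Filter.atTop, Literature.MathematicalPhysics.QuantumManyBody.BoseGas.groundStateEnergy v N (Literature.MathematicalPhysics.QuantumManyBody.BoseGas.sideLength ρ N) ≠ ⊤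

/-- item stmt-AtomisticToContinuum-3300 · support · rank 9 · closed · moot by None · by planner
sources: LSSY2005, PenroseOnsager1956
[support] for a normalised measurable mode u, trial states Ψ, Φ ∈ TrialState (n+1) L and |c| = 1:
occ(u,Ψ)^(1/2) ≤ occ(u,Φ)^(1/2) + (n+1)^(1/2)·‖Ψ − cΦ‖₂ (F_Ψ(Y) = ⟨u,Ψ(·,Y)⟩, |F_Ψ − cF_Φ| ≤
‖(Ψ−cΦ)(·,Y)‖₂, Minkowski in L²(dY), occ(cΦ) = occ(Φ)). [difficulty: provable-now] -/
@[route_item "route-AtomisticToContinuum-BECRieszLandscape"]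
def OccupationStability : Prop :=
  ∀ (n : ℕ) (L : ℝ) (u : Literature.MathematicalPhysics.QuantumManyBody.BoseGas.Space → ℂ), MeasureTheory.AEStronglyMeasurable u MeasureTheory.volume → ∫⁻ x, (‖u x‖₊ : ENNReal) ^ 2 = 1 → ∀ (Ψ Φ : Literature.MathematicalPhysics.QuantumManyBody.BoseGas.TrialState (n + 1) L) (c : ℂ), ‖c‖ = 1 → Literature.MathematicalPhysics.QuantumManyBody.BoseGas.occupation (n + 1) u Ψ.ψ ^ (1 / 2 : ℝ) ≤ Literature.MathematicalPhysics.QuantumManyBody.BoseGas.occupation (n + 1) u Φ.ψ ^ (1 / 2 : ℝ) + ((n + 1 : ℕ) : ENNReal) ^ (1 / 2 : ℝ) * (∫⁻ X, (‖Ψ.ψ X - c * Φ.ψ X‖₊ : ENNReal) ^ 2) ^ (1 / 2 : ℝ)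

/-- item stmt-AtomisticToContinuum-6488 · support · rank 9 · closed · moot by None · by planner
sources: LSSY2005, Stein1993
[support] CoarseGrainedReverseHolder → MicroscaleFlatness → PositiveZeroMode. Real analysis +
Fubini: for Ψ ≥ 0, ⟨φ₀,γ_Ψφ₀⟩ = N L⁻³ ∫dX̂ (∫Ψ(y,X̂)dy)² (occupation unfolds along Matrix.vecCons);
pointwise in X̂, with good cubes G, Σ_Q∫_Q Ψ ≥ √(c₀|Q|) Σ_G (∫_QΨ²)^{1/2} and Hölder Σ_G w_Q ≤ (Σ_G
w_Q^{1/2})^{2/3}(Σ w_Q²)^{1/3} give (∫Ψ_X̂)² ≥ c₀ L³ M(X̂)(1−b(X̂))³/C₂(X̂) with M the slice mass, b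
the bad-mass fraction, C₂ = m³Σ_Q w_Q²/M²; then Markov under μ̂ = M dX̂ (∫M = 1) using E_μ̂ C₂ ≤ C
and E_μ̂ b ≤ θ < 1; finally intersect the eventual ranges, min of ρ₀'s and δ's, shift n+1 ↦ N.
[difficulty: provable-now] -/
@[route_item "route-AtomisticToContinuum-BECRieszLandscape"]
def TwoScaleGlue : Prop :=
  CoarseGrainedReverseHolder → MicroscaleFlatness → PositiveZeroMode

/-- item stmt-AtomisticToContinuum-6489 · support · rank 9 · closed · moot by None · by planner
sources: LSSY2005, ReedSimonIV1978
[support] whenever E₀(N, L) < ⊤, for every δ > 0 there is a δ-near-minimiser Φ ∈ TrialState N L with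
Φ = ‖Φ‖ pointwise. Construction without mollifiers: from a δ/2-near-minimiser Ψ put Φ_ε := (√(|Ψ|² +
ε²) − ε)/‖·‖₂ — C¹ (|Ψ|² is C¹, t ↦ √(t+ε²) smooth), symmetric, vanishes exactly where Ψ does (box,
cores), |∇Φ_ε| ≤ |∇Ψ| and Φ_ε ≤ |Ψ| pointwise, ‖Φ_ε‖₂ → 1; so energy Φ_ε ≤ E₀ + δ for small ε.
[difficulty: provable-now] -/
@[route_item "route-AtomisticToContinuum-BECRieszLandscape"]
def PositiveNearMinimiserExists : Prop :=
  ∀ (v : ℝ → ENNReal) (N : ℕ) (L : ℝ), Literature.MathematicalPhysics.QuantumManyBody.BoseGas.groundStateEnergy v N L ≠ ⊤ → ∀ δ : ENNReal, 0 < δ → ∃ Φ : Literature.MathematicalPhysics.QuantumManyBody.BoseGas.TrialState N L, Literature.MathematicalPhysics.QuantumManyBody.BoseGas.energy v Φ ≤ Literature.MathematicalPhysics.QuantumManyBody.BoseGas.groundStateEnergy v N L + δ ∧ ∀ X, Φ.ψ X = (‖Φ.ψ X‖ : ℂ)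

/-- item stmt-AtomisticToContinuum-6490 · support · rank 9 · closed · moot by None · by planner
sources: LSSY2005, ReedSimonIV1978, PenroseOnsager1956
[support] GroundStateEnergyFinite → GroundStateRigidity → PositiveNearMinimiserExists →
OccupationStability → PositiveZeroMode → X_B1 (flat-mode occupation ≥ (c/4)N for ALL
δ-near-minimisers, the hypothesis of the proved
AtomisticToContinuum.BECInfraredBound.bec_of_zeroMode): for ρ below the four thresholds and N in the
four eventual ranges take η = c/4, δ = min(δ_pos, δ_rig(η)); a δ-near-minimiser Ψ and a positive
δ-near-minimiser Φ (exists since E₀ ≠ ⊤) are η-close up to a unit phase, occ(Φ) ≥ cN, and stability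
gives √occ(Ψ) ≥ √(cN) − √N√η = √(cN)/2 (ENNReal rpow bookkeeping; N = 0 trivial). [difficulty:
provable-now] -/
@[route_item "route-AtomisticToContinuum-BECRieszLandscape"]
def PositivityTransfer : Prop :=
  GroundStateEnergyFinite → GroundStateRigidity → PositiveNearMinimiserExists → OccupationStability → PositiveZeroMode → (∀ v : ℝ → ENNReal, Literature.MathematicalPhysics.QuantumManyBody.BoseGas.IsRepulsiveFiniteRange v → ∃ ρ₀ : ℝ, 0 < ρ₀ ∧ ∀ ρ : ℝ, 0 < ρ → ρ < ρ₀ → ∃ c : ℝ, 0 < c ∧ ∀ᶠ N : ℕ in Filter.atTop, ∃ δ : ENNReal, 0 < δ ∧ ∀ Ψ : Literature.MathematicalPhysics.QuantumManyBody.BoseGas.TrialState N (Literature.MathematicalPhysics.QuantumManyBody.BoseGas.sideLength ρ N), Literature.MathematicalPhysics.QuantumManyBody.BoseGas.energy v Ψ ≤ Literature.MathematicalPhysics.QuantumManyBody.BoseGas.groundStateEnergy v N (Literature.MathematicalPhysics.QuantumManyBody.BoseGas.sideLength ρ N) + δ → ENNReal.ofReal (c * N) ≤ Literature.MathematicalPhysics.QuantumManyBody.BoseGas.occupation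 N ((Literature.MathematicalPhysics.QuantumManyBody.BoseGas.box (Literature.MathematicalPhysics.QuantumManyBody.BoseGas.sideLength ρ N)).indicator fun _ => ((Real.sqrt (Literature.MathematicalPhysics.QuantumManyBody.BoseGas.sideLength ρ N ^ 3))⁻¹ : ℂ)) Ψ.ψ)

/-- item stmt-AtomisticToContinuum-6491 · assembly · rank 1 · closed · moot by None · by planner
sources: LSSY2005, PenroseOnsager1956
[assembly] CoarseGrainedReverseHolder → MicroscaleFlatness → TwoScaleGlue → GroundStateEnergyFinite
→ GroundStateRigidity → PositiveNearMinimiserExists → OccupationStability → PositivityTransfer →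
BoseEinsteinCondensation. -/
@[route_item "route-AtomisticToContinuum-BECRieszLandscape"]
def Assembly : Prop :=
  CoarseGrainedReverseHolder → MicroscaleFlatness → TwoScaleGlue → GroundStateEnergyFinite → GroundStateRigidity → PositiveNearMinimiserExists → OccupationStability → PositivityTransfer → Literature.MathematicalPhysics.QuantumManyBody.BoseGas.BoseEinsteinCondensation

end Summit.AtomisticToContinuum.BoseEinsteinCondensation.Theses.BECRieszLandscape
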